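import Summits.BirchSwinnertonDyer.BirchSwinnertonDyer.Theses.ResidualThetaTransportAtTwo
import Summits.BirchSwinnertonDyer.BirchSwinnertonDyer.Theorems.ResidualThetaTransportAtTwoAwayDefs
import Summits.BirchSwinnertonDyer.BirchSwinnertonDyer.Theorems.ResidualThetaTransportAtTwoResidualSignedLambdaLowerCMAtTwoDeepHalfAtTwoOfPins
import Summits.BirchSwinnertonDyer.BirchSwinnertonDyer.Theorems.ResidualThetaTransportAtTwoResidualSignedLambdaLowerCMAtTwoAwayExhaustion
import Summits.BirchSwinnertonDyer.BirchSwinnertonDyer.Theorems.ResidualThetaTransportAtTwoResidualSignedLambdaLowerCMAtTwoRhoLayerPairingGlueAwayTwo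
import Summits.BirchSwinnertonDyer.BirchSwinnertonDyer.Theorems.ResidualThetaTransportAtTwoResidualSignedLambdaLowerCMAtTwoStubDeepHalfAtTwoStrictPins
import Literature.NumberTheory.EllipticCurves.Kato2004.IwasawaCohomologyCoeffNewform
import HarnessLib

/-!
# S4₂ `stub_deepHalfAtTwoStrict` of line `onepair` — the registered text BY NAME, modulo the ONE missing pin (`ζ`-compatibility)

Route `ResidualThetaTransportAtTwo` (RTT), crux RSL_g `ResidualSignedLambdaLowerCMAtTwo` (stmt-BirchSwinnertonDyer-22608), line «onepair», skeleton
v3a (`Cruxes/ResidualSignedLambdaLowerCMAtTwo/Lines/onepair.lean`, sha16 5e6e1bb525182a96), split stub **S4₂ `stub_deepHalfAtTwoStrict`** (lane of seat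
`prover-bsd-wall-tp2-p2x-w2`, g19 audit / g20 proof; `--supports`, closes nothing by itself). THEOREMS ONLY (no definition, no named fact, no instance,
no `sorry`). BSD is not proved by any of this; RSL_g (22608) and K3 (20308) stay OPEN.

**`stub_deepHalfAtTwoStrict`**: the registered S4₂ text (v3a) VERBATIM with ONE extra binder inserted right after the pin bundle `π`,
`(hζ2 : ∀ k : ℕ, π.ζ (k + 1) ^ 2 = π.ζ k)` (= the v3b text announced by the LEAD, cell STATUS 2026-08-29T06:03:29Z) — the compatibility of the chosen primitive `2^k`-th roots, which `OnePairPins` (as recorded) does not carry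
(its field `hζ` only says «primitive»; w2 g19 input audit, cell STATUS 2026-08-29T05:50:28Z) and without which the tower compatibility `htower` consumed
by the assembly (p695648 → `DeepHalfValueTransfer.layerPairingH1Of_succ_compat`) is not derivable from the pins. With v3b registered this IS the stub
by name (S2 precedent `…Theorems.OnePair.stub_plusColemanO`): the skeleton's `stub_deepHalfAtTwoStrict` becomes this theorem.

Proof = `CofreeSelmerTransfer.exists_iwasawaH1_locd₂_eq_strict_of_pins` (p697034 = p695648 ∘ GLUE-67 p695317) fed BY NAME:
`ePk/hμPk/hadd₁Pk/hadd₂Pk/hgalPk/pair/hpair/locd₂/hlocd₂/v/hv` = fields of `π`; `htower` = `π.ePk_tower_of_zeta_sq hζ2`, `hnondeg` = `π.ePk_nondegenerate`,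
`hρ` = `OnePairPins.isUnramifiedAt_of_habitat` (text habitat clause + `ℓ_v ∣ M → v ∈ S₀`), `[CompactSpace 𝒪]` = `compactSpace_coeffO_of_finiteDimensional`
(p701765); `Rel := ↑selRelSubgroup` (`hRel` by `mem_selRelSubgroup_iff`, dropping the Kummer clause), `C := fun s ↦ π₂.c₂ z (locKer … π.v s)`, `hH` = the
text's (H), `hval` = `π₂.hc₂` on the pulled-back cocycle (`locKer_oneCocycleClass` / `locKer_pullback_apply`, p700007), floor `N₀ := 0`, `a := 1`; and
`πₐ.locdS x = 0` = frame separation `ProfiniteExhaustion.pAway_eq_zero_of_jAway` (p700479) + value pin `πₐ.hlocdS` + the Greenberg–Vatsal ∀σ-strictness of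
the assembly's output read through `layerPairingOf_reduce_conjMap_eq_zero_of_resOfLe_decomp_eq_zero` (p697034 §1).

References: [Kato2004Asterisque] §12.2 (p. 220), §13.8 (pp. 228–229); [MilneADT2006] I Thm. 4.10 (b); [PerrinRiou1994Invent] §3.6.1;
[GreenbergVatsal2000] §2 Prop. 2.4; [Kobayashi2003] (8.23) (p. 18).
-/

set_option autoImplicit false
-- the Theorems namespace of this sub repeats the summit name by design (D-0017 nested layout)
set_option linter.dupNamespace false

noncomputable section

open scoped Classical

namespace Summit.BirchSwinnertonDyer.BirchSwinnertonDyer.Theorems.OnePair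

open CategoryTheory Field NumberField IsDedekindDomain WeierstrassCurve
  Literature.NumberTheory.EllipticCurves Literature.NumberTheory.GaloisRepresentations
  Literature.NumberTheory.EllipticCurves.GreenbergSelmer Literature.NumberTheory.EllipticCurves.CyclotomicLayer
  Literature.NumberTheory.EllipticCurves.Kato2004
  Summit.BirchSwinnertonDyer.BirchSwinnertonDyer.Theorems.ThetaTransport

set_option maxHeartbeats 1000000 in
/-- **S4₂ `stub_deepHalfAtTwoStrict` (v3b text: v3a + the `hζ2` binder)** (Poitou–Tate deep half at `2`, strict at `S₀`): for every datum of RSL_g, every pin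
bundle `π` WITH COMPATIBLE ROOTS `ζ_{k+1}² = ζ_k`, every `π₂ : AtTwoPins π`, `πₐ : AwayPins π`, a functional `z` on tower tuples at `v ∣ 2` killing
`c₂ z ∘ loc₂` on the relaxed Selmer group is `locd₂ x` (`a = 1`) for some `x ∈ 𝐇¹_Γ(T_ρ)` with `locd_S x = 0`. The registered text verbatim but
for the one inserted binder. [cite: MilneADT2006, Ch. I, Thm. 4.10] [cite: PerrinRiou1994Invent, §3.6.1] [cite: Kato2004Asterisque, §13.8 (pp. 228–229)] -/
theorem stub_deepHalfAtTwoStrict :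
    open Literature.NumberTheory.EllipticCurves GreenbergSelmer GreenbergVatsal2000 Kobayashi2003 ModularForms Rank1Residual Literature.NumberTheory.GaloisRepresentations Literature.NumberTheory.Automorphic IsDedekindDomain NumberField Field Rat.HeightOneSpectrum PowerSeries Summit.BirchSwinnertonDyer.BirchSwinnertonDyer.Theorems.OnePair in ∀ (W : WeierstrassCurve ℚ) [W.IsElliptic] [W.IsGloballyMinimal], GoodSS W 2 → W.frobeniusTrace 2 = 0 → W.Δ < 0 → ∀ (M : ℕ) [NeZero M] (g : CuspForm (CongruenceSubgroup.Gamma0 M) 2) (ι : coeffField g →+* PadicAlgCl 2), Odd M → IsNewform0 g → IsCMForm (liftToGamma1 M 2 g) → cuspCoeff g 2 = 0 → (∀ ℓ : ℕ, ℓ.Prime → ¬ ℓ ∣ 2 * M * W.conductorNorm ℤ → ‖embCoeff g ι ℓ - (W.frobeniusTrace ℓ : PadicAlgCl 2)‖ < 1) → ∀ (κ : ZpExtension ℚ 2) (γ : absoluteGaloisGroup ℚ), κ.IsCyclotomic → κ.IsTopGenerator γ → IsCyclotomicVariable 2 γ → ∀ (S₀ : Finset (HeightOneSpectrum (RingOfIntegers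 ℚ))), (∀ v ∈ S₀, ((2 : ℕ) : RingOfIntegers ℚ) ∉ v.asIdeal) → (∀ v, ¬ W.HasGoodReductionAt v → v ∈ S₀) → (∀ v, natGenerator v ∣ M → v ∈ S₀) → ∀ (n : ℕ) (ρ : FramedGaloisRep ℚ (coeffO (Set.range ι)) 2) (Θ : ∀ v : HeightOneSpectrum (RingOfIntegers ℚ), ((2 : ℕ) : RingOfIntegers ℚ) ∈ v.asIdeal → (CofreeF (Set.range ι) ρ ≃+ (Fin n → ↥(W.geomPrimaryTorsion 2)))), (∀ v, ¬ natGenerator v ∣ 2 * M → ρ.IsUnramifiedAt v ∧ ∃ P : Polynomial (coeffO (Set.range ι)), P.map (padicCoeffIntegers (Set.range ι)).subtype = Polynomial.X ^ 2 - Polynomial.C (embCoeff g ι (natGenerator v)) * Polynomial.X + Polynomial.C ((natGenerator v : ℕ) : PadicAlgCl 2) ∧ ρ.HasFrobCharpolyAt v P) → ∀ (hΘ : ∀ v hv (δ : absoluteGaloisGroup (v.adicCompletion ℚ)) m i, Θ v hv (resGalOfEmb (closureEmb (K := ℚ) (v.adicCompletion ℚ)) δ • m) i = resGalOfEmb (closureEmb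 (K := ℚ) (v.adicCompletion ℚ)) δ • Θ v hv m i), ∀ (ϖ : (coeffO (Set.range ι))), Irreducible ϖ → ∀ (Sg : AddSubgroup (H1Γ (Set.range ι) κ ρ)) [Module (coeffO (Set.range ι)) ↥Sg], (∀ (a : (coeffO (Set.range ι))) (s : ↥Sg), ((a • s : ↥Sg) : H1Γ (Set.range ι) κ ρ) = scalarH1 κ.kerSubgroup (CofreeF (Set.range ι) ρ) a s) → (∀ y : H1Γ (Set.range ι) κ ρ, y ∈ Sg ↔ y ∈ plusSelmerSet (Set.range ι) W κ S₀ n ρ Θ) → (∀ (τ : absoluteGaloisGroup ℚ) (y : H1Γ (Set.range ι) κ ρ), y ∈ Sg → conjH1 κ.kerSubgroup (CofreeF (Set.range ι) ρ) τ y ∈ Sg) → (plusSelmerTorsionSet (Set.range ι) W κ S₀ n ρ Θ ϖ).Finite → ∀ (I : Kato2004.IwasawaH1DataCoeff (FramedGaloisRep.toGaloisRep ρ) 2 κ γ) [Module (coeffO (Set.range ι)) I.H] [IsScalarTower (coeffO (Set.range ι)) (IwasawaAlgebraO (Set.range ι)) I.H], (∀ (a : (coeffO (Set.range ι))) (x :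 I.H), a • x = (PowerSeries.C a : IwasawaAlgebraO (Set.range ι)) • x) → ∀ (π : OnePairPins (Set.range ι) W κ γ S₀ n ρ Θ hΘ I Sg) (hζ2 : ∀ k : ℕ, π.ζ (k + 1) ^ 2 = π.ζ k), ∀ [Module ℤ_[2] (Dloc (Set.range ι) κ ρ π.v)] (π₂ : AtTwoPins (Set.range ι) κ ρ S₀ W γ n Θ hΘ I Sg π) [∀ w : ↥S₀, Module ℤ_[2] (Dloc (Set.range ι) κ ρ (w : HeightOneSpectrum (RingOfIntegers ℚ)))] (πₐ : AwayPins (Set.range ι) κ ρ S₀ W γ n Θ hΘ I Sg π), ∀ z : (Fin n → ↥(Sprung2012.localTowerPointsOfEmb κ (closureEmb (K := ℚ) (π.v.adicCompletion ℚ)) W)) →+ ℤ_[2], (∀ s : H1Γ (Set.range ι) κ ρ, s ∈ selRelSubgroup (Set.range ι) κ ρ S₀ → π₂.c₂ z (locKer (Set.range ι) κ ρ π.v s) = 0) → ∃ a : ℤ_[2], a ≠ 0 ∧ ∃ x : I.H, πₐ.locdS x = 0 ∧ a • z = π.locd₂ x := by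
  intro W _ _ hss ha2 hΔ M _ g ι hodd hnew hcm hcusp hcong κ γ hκ hγ hcyc S₀ hS₀2 hbad hMS₀ n ρ Θ hρ hΘ ϖ hϖ Sg _ hsmul hSg hconj hfin
    I _ _ hIsmul π hζ2 _ π₂ _ πₐ z hH
  haveI : FiniteDimensional ℚ (ModularForms.coeffField g) := ModularForms.IsNewform0.finiteDimensional_coeffField_holds hnew
  haveI : CompactSpace (coeffO (Set.range ι)) := OnePairPins.compactSpace_coeffO_of_finiteDimensional ι
  obtain ⟨x, hxz, hx⟩ := CofreeSelmerTransfer.exists_iwasawaH1_locd₂_eq_strict_of_pins (Set.range ι) ρ W π.ePk π.hμPk π.hadd₁Pk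
    π.hadd₂Pk π.hgalPk (π.ePk_tower_of_zeta_sq hζ2) π.ePk_nondegenerate Θ κ π.v hΘ hκ π.hv S₀ hS₀2
    (OnePairPins.isUnramifiedAt_of_habitat (ρ := ρ) (fun v hv ↦ (hρ v hv).1) hMS₀) I π.pair π.hpair π.hlocd₂ 0 z
    (↑(selRelSubgroup (Set.range ι) κ ρ S₀)) (fun y hy ↦ (mem_selRelSubgroup_iff (Set.range ι) κ ρ S₀ y).mpr ⟨hy.1, hy.2.1⟩)
    (fun s ↦ π₂.c₂ z (locKer (Set.range ι) κ ρ π.v s))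
    (fun s _ φ Q k' hQ hφ hτ ↦ by
      subst hφ
      change π₂.c₂ z (locKer (Set.range ι) κ ρ π.v (oneCocycleClass _ φ)) = _
      rw [locKer_oneCocycleClass]
      exact π₂.hc₂ z _ _ Q k' hQ rfl (fun τ i ↦ by rw [locKer_pullback_apply]; exact hτ τ i))
    (fun s hs ↦ hH s hs)
  refine ⟨1, one_ne_zero, x, ?_, by rw [one_smul, hxz]⟩
  refine ProfiniteExhaustion.pAway_eq_zero_of_jAway (Set.range ι) κ ρ S₀ (πₐ.locdS x) fun w c m hm k y' ↦ ?_
  rw [πₐ.hlocdS w c m hm k x y',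
    CofreeSelmerTransfer.layerPairingOf_reduce_conjMap_eq_zero_of_resOfLe_decomp_eq_zero (Set.range ι) ρ k κ w m _ _ _ _ _ c.out
      (I.proj m x) ((hx m k (Nat.zero_le m)).2.1 w w.2 c.out),
    AddMonoidHom.zero_apply, ZMod.val_zero, zero_smul]

end Summit.BirchSwinnertonDyer.BirchSwinnertonDyer.Theorems.OnePair

end
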